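import Mathlib
import Summits.Ventures.FusionMHD.Models.CerfonFreidbergIterLikeQHalfResDefs
import HarnessLib

/-!
# Ventures/FusionMHD — Models/CerfonFreidbergIterLikeQHalfResPanels11.lean: KERNEL CHECK of the resistive-register certificates of panel(s) 18, 19 (of 32)
# at `ψ_N = 1/2` of THE Cerfon–Freidberg ITER-like instance

HONEST FRAMING (LADDER-GRIDFUSION three columns; CF rung; rider «D_R at ψ_N = 1/2»).  One `decide +kernel` (≈ 60–90 s): for each listed panel the obligation
`CFIterLike.QHalfRes.ResCert.ok` (`Models/CerfonFreidbergIterLikeQHalfResDefs.lean`) — the Taylor-model run of `progR = progM ++ block3R` over ★ #117's parameter box is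
ACCEPTED and the kernel's two panel-integral enclosures (`g_AG`, `g_W` along the approximant) lie inside the claimed integers (compiled `#eval` of the same functions, slack
one unit of `2⁻⁶⁰`; float truth inside every panel, `genqm/truthR.json`).  MODELLED: analytic Cerfon–Freidberg family; nothing about a device or stability.
No `native_decide`.  Typer/prover: gridfusion-model-7 (g7), 2026-08-28.  Citations: Zheng 2015 §3.2 (3.42) [Zheng2015];
Mahboubi–Melquiond–Sibut-Pinote 2016 §3.2 Lemma 3 [MahboubiMelquiondSibutpinote2016].
-/

namespace Summit.Ventures.FusionMHD.Models.CFIterLike.QHalfRes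

/-- Resistive-register certificate data of panel(s) 18, 19. [instance data] -/
def resCert11 : List ResCert := [
  { j := 18, cand1 := [1917128418216080048128, 14290411919854150877184, -43157797666846333206528, -1033853553678832120102912, -1392825373505479054983168, 54315521258294331433811968, 264363417986266034513903616, -2144627821695429093867126784, -21453017156890057846487515136, 49164883062105310240293519360, 1311593098830829143290590265344, 1146670137983276283848070004736, -62403449876624163006576355966976],
    cand2 := [1826107259928697634816, 12808479661948384837632, -128019022238714593017856, -1886589766702905862127616, 7732399052710290590269440, 239440030363972444128018432, -50385721216197720014848000, -27135881534526199401405218816, -86158755521526497507096395776, 2759450683089180586557841604608, 18917336394008192470967688101888, -233215576517276151365022391468032, -2672976555775498188333297453498368],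
    deg := 10, e1 := 46, e2 := 46, glo := 3843993576972501, ghi := 3843994032764252, wlo := 459234899811128688, whi := 459234946208341895 },
  { j := 19, cand1 := [2290464041673517170688, 8682216023434981277696, -129683621061482474635264, -615378744389384068399104, 7665895308515436172148736, 37953485174968793660653568, -444274253466291714675179520, -2175254959422275146601201664, 25459129516580028852635435008, 119460625800232682169303040000, -1449161658565077516368354476032, -6102716844636946702540862390272, 85747959798188262130816678625280],
    cand2 := [2057461268023605723136, 1184769458972003663872, -203283110931262966071296, 572434048528163633364992, 20675921886906190558920704, -137140606292428796219883520, -1817951646457857248459751424, 21890905817745210524240445440, 123835538695618633719489757184, -2891036838622353603549097623552, -3333939883616601434648215552000, 310144029434145901414763271815168, -694294813235155764995050711285760],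
    deg := 10, e1 := 46, e2 := 46, glo := 3914260805006324, ghi := 3914261196188897, wlo := 456217593800832182, whi := 456217633112605297 }]

/-- **KERNEL CHECK** of the two resistive registers on panel(s) 18, 19. -/
theorem resCert11_ok : CFIterLike.QHalfRes.resCert11.all ResCert.ok = true := by
  decide +kernel

end Summit.Ventures.FusionMHD.Models.CFIterLike.QHalfRes
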